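import Literature.NumberTheory.DiophantineGeometry.GenEllDeFamilyGoodPrimes
import Literature.NumberTheory.DiophantineGeometry.GenEllDeGoodPrimesOrd
import HarnessLib

/-!
# [GenEll] Thm. 2.1 on the `D_e` route, FAMILY version `t_c`: the good-place multiplicity
# inequalities in `ord` form and the junction with the summation over all places

S. Mochizuki, *Arithmetic elliptic curves in general position*, Math. J. Okayama Univ. 52 (2010),
Prop. 1.6 p. 10 (reduced divisor), proof of Thm. 2.1 pp. 12–13 [cite: MochizukiGenEll2010, Prop 1.6 p.10].
Support file for the route item `GenEllTwo` (stmt-ABC-19679), package W5 for the family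
`t_c = 1/r + c·r^{k+1}/s` (S6 OWNER RULING #6); W5 coordinator abc-iut-w5-d045. The case `c = 1` is
`GenEllDeGoodPrimesOrd.lean`. Classical; nothing here bears on [IUTchIII] Cor. 3.12.

* `DeC.ord_placewise_of_gap`: at a finite place `w` of a number field `L` with `w(2) = w(c) = 1` the
  dichotomy `DeC.good_place_dichotomy_of_gap` becomes the placewise hypotheses of
  `FibreConductor.sum_logNorm_le_of_placewise` / `sum_logNorm_le_slope` (abc-iut-w5-d009) with ZERO
  defect at `w` (`ord = Literature.IUT.LogVolume.ord`, `ord⁺ := Int.toNat ∘ ord`, `τ_b := t − b`, `a := N_c`);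
* `DeC.hmeet_hoff_of_gap`: the packaged junction off a finite bad set `Sbad`, VERBATIM `hmeet`/`hoff` of
  `FibreConductor.sum_logNorm_le_slope` (the finite meeting set `W` from `De.finite_setOf_meets`).
-/

noncomputable section

namespace Literature.NumberTheory.DiophantineGeometry.GenEll

open _root_.Polynomial NumberField IsDedekindDomain
open Literature.IUT.LogVolume

variable {L : Type*} [Field L] [NumberField L]

/-- **Good-place multiplicity inequalities in `ord` form for `t_c`** (descent-friendly hypotheses):
at a finite place `w` of a number field `L` with `w(2) = w(c) = 1`, for a point `(r, s, t)` of `D_e`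
(`s² = 1 − 4r^{2k+1}`, `t·(rs) = s + c·r^{k+2}`) with `N_c ≠ 0` and `t ∉ B`, `B` `w`-integral and pairwise
distinct modulo `w`, each `G^c_b` satisfying the gap conclusion at `w`, and the converse direction
`hconv`: if `t` meets `B` at `w` then `1 + ord⁺_w N_c ≤ Σ_b ord⁺_w (t − b)`, otherwise
`ord⁺_w N_c ≤ Σ_b ord⁺_w (t − b)`. [cite: MochizukiGenEll2010, Prop 1.6 p.10] -/
theorem DeC.ord_placewise_of_gap (w : HeightOneSpectrum (𝓞 L)) (k : ℕ) {c : L}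
    (hv2 : w.valuation L 2 = 1) (hcv : w.valuation L c = 1)
    {r s t N : L} (hcurve : s ^ 2 = 1 - 4 * r ^ (2 * k + 1)) (ht : t * (r * s) = s + c * r ^ (k + 2))
    (hN : N = -s ^ 3 + c * ((k + 1) * r ^ (k + 2) - 2 * r ^ (3 * k + 3))) (hN0 : N ≠ 0)
    (B : Finset L) (htB : ∀ b ∈ B, t ≠ b) (hB : ∀ b ∈ B, w.valuation L b ≤ 1)
    (hBsep : ∀ b ∈ B, ∀ b' ∈ B, b ≠ b' → w.valuation L (b - b') = 1)
    (g : L → L[X])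
    (hg : ∀ b ∈ B, g b = C (c ^ 2) * X ^ (2 * k + 4) + C (4 * b ^ 2) * X ^ (2 * k + 3)
      - C (8 * b) * X ^ (2 * k + 2) + C 4 * X ^ (2 * k + 1) - C (b ^ 2) * X ^ 2 + C (2 * b) * X - 1)
    (hgap : ∀ b ∈ B, ∀ ρ : L, w.valuation L ρ ≤ 1 → (g b).eval ρ ≠ 0 →
      w.valuation L ((g b).eval ρ) < 1 →
      w.valuation L ((g b).eval ρ) < w.valuation L ((derivative (g b)).eval ρ))
    (hconv : w.valuation L N < 1 → ∃ b ∈ B, w.valuation L (t - b) < 1) :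
    ((∃ b ∈ B, 0 < ord L w (t - b)) →
        1 + (ord L w N).toNat ≤ ∑ b ∈ B, (ord L w (t - b)).toNat) ∧
      ((¬ ∃ b ∈ B, 0 < ord L w (t - b)) → (ord L w N).toNat ≤ ∑ b ∈ B, (ord L w (t - b)).toNat) := by
  classical
  have htb0 : ∀ b ∈ B, t - b ≠ 0 := fun b hb => sub_ne_zero.mpr (htB b hb)
  rcases DeC.good_place_dichotomy_of_gap (w.valuation L) k hv2 hcv hcurve ht hN hN0 B hB hBsep g hg
      hgap hconv with ⟨b₀, hb₀, hlt1, hltN, hothers⟩ | ⟨hall, hN1⟩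
  · have hpos : 0 < ord L w (t - b₀) := (ord_pos_iff_valuation_lt_one L w (htb0 b₀ hb₀)).2 hlt1
    have hzero : ∀ b ∈ B, b ≠ b₀ → (ord L w (t - b)).toNat = 0 := fun b hb hne => by
      rw [ord_eq_zero_of_valuation_eq_one w (hothers b hb hne), Int.toNat_zero]
    have hsum : ∑ b ∈ B, (ord L w (t - b)).toNat = (ord L w (t - b₀)).toNat := by
      rw [← Finset.sum_erase_add _ _ hb₀, Finset.sum_eq_zero fun b hb => ?_, zero_add]
      exact hzero b (Finset.mem_of_mem_erase hb) (Finset.ne_of_mem_erase hb)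
    have hmain : 1 + (ord L w N).toNat ≤ (ord L w (t - b₀)).toNat := by
      have hlt : ord L w N < ord L w (t - b₀) := (ord_lt_ord_iff w (htb0 b₀ hb₀) hN0).2 hltN
      have h1 : ((ord L w (t - b₀)).toNat : ℤ) = ord L w (t - b₀) := Int.toNat_of_nonneg hpos.le
      zify
      rw [h1]
      rcases le_or_gt 0 (ord L w N) with h | h
      · rw [Int.toNat_of_nonneg h]; omega
      · rw [Int.toNat_eq_zero.mpr h.le]; push_cast; omega
    exact ⟨fun _ => hsum ▸ hmain, fun hno => absurd ⟨b₀, hb₀, hpos⟩ hno⟩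
  · have hN0' : (ord L w N).toNat = 0 :=
      Int.toNat_eq_zero.mpr (ord_nonpos_of_one_le_valuation w hN1)
    refine ⟨fun ⟨b, hb, hpos⟩ => ?_, fun _ => by rw [hN0']; exact Nat.zero_le _⟩
    have := (ord_pos_iff_valuation_lt_one L w (htb0 b hb)).1 hpos
    exact absurd (hall b hb) (not_le.mpr this)

/-- **The W5 → W5d junction for the family `t_c`**: off a finite set `Sbad` of places at which `2`, `c`
and the values `b ∈ B` are units/integral with good reduction of every `G^c_b` (gap conclusion) and
the converse direction, and with `W` any finite set of places off `Sbad` at which `t` meets `B` (e.g. the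
primes over the conductor support of `z = β(t)`, via `FibreConductor.meets_of_under`), the point satisfies
VERBATIM the hypotheses `hmeet`/`hoff` of `FibreConductor.sum_logNorm_le_slope` /
`inv_finrank_mul_sum_logNorm_le_slope` (with `a := N_c`, `τ b := t − b`).
[cite: MochizukiGenEll2010, Prop 1.6 p.10] -/
theorem DeC.hmeet_hoff_of_gap (k : ℕ) {c r s t N : L}
    (hcurve : s ^ 2 = 1 - 4 * r ^ (2 * k + 1)) (ht : t * (r * s) = s + c * r ^ (k + 2))
    (hN : N = -s ^ 3 + c * ((k + 1) * r ^ (k + 2) - 2 * r ^ (3 * k + 3))) (hN0 : N ≠ 0)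
    (B : Finset L) (htB : ∀ b ∈ B, t ≠ b) (g : L → L[X])
    (hg : ∀ b ∈ B, g b = C (c ^ 2) * X ^ (2 * k + 4) + C (4 * b ^ 2) * X ^ (2 * k + 3)
      - C (8 * b) * X ^ (2 * k + 2) + C 4 * X ^ (2 * k + 1) - C (b ^ 2) * X ^ 2 + C (2 * b) * X - 1)
    (Sbad W : Finset (HeightOneSpectrum (𝓞 L)))
    (h2 : ∀ w, w ∉ Sbad → w.valuation L 2 = 1) (hc : ∀ w, w ∉ Sbad → w.valuation L c = 1)
    (hB : ∀ w, w ∉ Sbad → ∀ b ∈ B, w.valuation L b ≤ 1)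
    (hBsep : ∀ w, w ∉ Sbad → ∀ b ∈ B, ∀ b' ∈ B, b ≠ b' → w.valuation L (b - b') = 1)
    (hgap : ∀ w, w ∉ Sbad → ∀ b ∈ B, ∀ ρ : L, w.valuation L ρ ≤ 1 → (g b).eval ρ ≠ 0 →
      w.valuation L ((g b).eval ρ) < 1 →
      w.valuation L ((g b).eval ρ) < w.valuation L ((derivative (g b)).eval ρ))
    (hconv : ∀ w, w ∉ Sbad → w.valuation L N < 1 → ∃ b ∈ B, w.valuation L (t - b) < 1)
    (hW : ∀ w ∈ W, w ∉ Sbad → ∃ b ∈ B, 0 < ord L w (t - b)) :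
    (∀ w ∈ W, w ∉ Sbad → 1 + (ord L w N).toNat ≤ ∑ b ∈ B, (ord L w (t - b)).toNat) ∧
      (∀ w, w ∉ W → w ∉ Sbad → (ord L w N).toNat ≤ ∑ b ∈ B, (ord L w (t - b)).toNat) := by
  refine ⟨fun w hwW hwS => ?_, fun w _ hwS => ?_⟩
  · exact (DeC.ord_placewise_of_gap w k (h2 w hwS) (hc w hwS) hcurve ht hN hN0 B htB (hB w hwS)
      (hBsep w hwS) g hg (hgap w hwS) (hconv w hwS)).1 (hW w hwW hwS)
  · have hp := DeC.ord_placewise_of_gap w k (h2 w hwS) (hc w hwS) hcurve ht hN hN0 B htB (hB w hwS)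
      (hBsep w hwS) g hg (hgap w hwS) (hconv w hwS)
    by_cases h : ∃ b ∈ B, 0 < ord L w (t - b)
    · have h1 := hp.1 h; omega
    · exact hp.2 h

end Literature.NumberTheory.DiophantineGeometry.GenEll
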